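/-
COR-CM (cells pub-hodgecm ∕ pub-hodgecm2, stage 2 of the Hodge ladder) — Δ2 BRIDGE, VERSION-B item (1)(b) «Ω-PIN AT δ′»: the X3-ω binders
`σ ∕ hσ ∕ e ∕ he` (group (b) of the assembler's pin signatures DECISION #8∕#9, `thm418C_ofTower_of_pins` ∕ `thm418C_liuDictionaryPin_of_pins`,
= the `σ ∕ hσ ∕ e ∕ he` binders of `Thm418COfPieces` thm 1–4) AT THE INDEX LINES of the pinned dictionary, on top of
`CorCM/D2Bridge/OmegaAtDeltaPrime.lean` (prove-4 g1: the rest `restOfCharDeltaPrime … r μ hμ hw` at the ε-normaliser of record `δ′ = (2δ_F)⁻¹`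
and R1 there at the splitting `ι_{toHecke μ}`).

WHAT THIS FILE ADDS (pin plumbing, no print content; THEOREMS ONLY).  At the pinned dictionary `T := liuDictionaryPin … V I line` (port
`HodgeCM/Model/LiuDictionaryPin.lean`; = `LiuDictionary.ofTower … I (fun i ↦ {χ ∕∕ (line i).IsAutChar χ}) (fun i a ↦ (line i).Ω (ιVE V) a.1) …`
by `rfl`) the binder `T.Ω i a` is LITERALLY the carrier `Representation.asModule ((HodgeCM.WeilCoinv.weilCoinv … (line i).JW … χ (line i).hs).comp ιV)`
of `HodgeCM.Model.SplitLine.Ω` (`HodgeCM/Model/LiuDictionaryInstance.lean` :124) at the line's OWN pair splitting `(line i).s` — an arbitrary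
compatible splitting, a component of the index — whereas `omegaTransportAtDeltaPrime` (prove-4) is stated at the splitting
`chiSplittingLine … (toHeckeCharacter F μ) …` attached to `μ`, and at the rest `restOfCharDeltaPrime …` whereas the composition reads the rest as
`(U i hμ hg).rest (tail i hμ hg)` for the per-line uniform carriers `U i` of record (DECISION #9).  The three seams are EQUATIONS OF TREE OBJECTS,
each crossed here by a `subst` on a local variable and supplied per index BY NAME at the composition: (s) `(line i).s = ι_{toHecke μ_i}`
(X3-Char at the line: [GelbartRogawski1991, Remark p. 457] «a choice of `s` is equivalent to a choice of Hecke character»; tree theorem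
`Def411WeilCarriersDoubling.exists_eq_chiSplittingLine_of_isCompatible` modulo `CentralCharFactorsThroughDet` + the archimedean type reading —
the pin keys' `hsEq`, NOT proved here), (R) `restOfCharDeltaPrime … (repOfLine a_i) μ_i hμ_i hw_i = (U i hμ hg).rest (tail i hμ hg)` (own-htheta's
`Model.restOfCharRep_eq_rest`, `rfl` — the keys' `hR`; measured: NOT free by unification inside `omegaAt`-typed goals, > 2·10⁶ heartbeats, hence
a binder) and (χ) the package's `IsAutChar χ` = «open kernel ∧ trivial rational restriction» (`SplitLine.isAutChar_iff` — the family's `hGC`).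
RESULT: `exists_omegaPin_line` (ONE line, loose fields over the tree's `CMField`: `σ ∕ hσ ∕ e ∕ he` exist)
and `exists_omegaPin` (THE FAMILY FORM at an index family `line : Char → SplitLine (diagonal dV) …` of port lines over `L : HodgeCM.CMField`,
rests read at `⟨L.K⟩ ∕ ⟨V.Hm, …⟩` exactly as the assembler's `C`): one `obtain ⟨σ, hσ, e, he⟩` discharges group (b) of
`thm418C_liuDictionaryPin_of_pins` given the per-line δ′-keys `(r_i, μ_i, hμ_i, hw_i, R_i, hR_i, ε_i, hε_i, hΦ_i, hT_i, hJ_i, hsEq_i)`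
(farm-checked end-to-end at the literal pin, desk `HOME/d2bridge/prove-6/Thm418CAtPinOmegaKeys.snippet.lean`).
Seat prover-pub-hodgecm2-d2bridge-prove-6-g0-0 (Δ2 bridge prove-6 gen 0; pair d2bridge-prove-7, consultant own-htheta g10).  Two theorems; no
definition, no named fact, no instance, no `variable`; the port modules and prove-4's file are IMPORTED, never restated.  HC_CM is NOT proved;
«Δ2 BRIDGE CLOSED» is NOT claimed; hLiu = «[Liu21] Thm 4.18 at the constructed objects AS A READING (r8 stronger-in-X; Δ2 bridge OPEN)» until
the pins land and the referee signs; no pointer moves.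
-/
import Summits.HodgeConjecture.CorCM.D2Bridge.OmegaAtDeltaPrime
import Summits.HodgeConjecture.HodgeCM.Model.LiuDictionaryInstance
import HarnessLib

set_option autoImplicit false

/-!
# The Ω-pin at δ′: `σ ∕ hσ ∕ e ∕ he` exist at every good index line

* §1 `Model.exists_omegaPin_line` — ONE line given by loose fields `(T_W′, J_W′, s)` with `hT ∕ hJ` (line of record), `hsEq : s = ι_{toHecke μ}`,
  a rest `R` with `hR : restOfCharDeltaPrime … = R`, and a family of characters `χof : Adm → (U(J_W′)(𝔸_f) →* ℂˣ)` with open kernels and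
  trivial rational restrictions (`hGC`), injective (`hχof`): `∃ σ (hσ) e, (equivariance)` — prove-4's
  `admIndexAtDeltaPrime ∕ _injective ∕ omegaTransportAtDeltaPrime ∕ _smul` after `subst hR; subst hsEq`;
* §2 `Model.exists_omegaPin` — THE FAMILY FORM over `line : Char → HodgeCM.Model.SplitLine (diagonal dV) …`, cut predicates `PhiMu Good`,
  per-line δ′-keys; conclusion = binder group (b) of the assembler's pin signatures with rests `R i hφ hg`.

HC_CM is NOT proved.
-/

noncomputable section

open scoped TensorProduct Matrix

namespace Summit.HodgeConjecture.CorCM.Model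

open CategoryTheory CategoryTheory.Limits AlgebraicGeometry NumberField IsDedekindDomain
open Literature.AlgebraicGeometry.Motives
open Literature.AlgebraicGeometry.HodgeTheory
open Literature.AlgebraicGeometry.ShimuraVarieties
open Literature.AlgebraicGeometry.ShimuraVarieties.UnitaryCanonicalModel
open Literature.AlgebraicGeometry.Liu2021 (IsAdmissibleElement)
open Literature.NumberTheory.ComplexMultiplication
open Literature.NumberTheory.Automorphic
open Literature.NumberTheory.Automorphic.IdeleClassGroup
open Literature.NumberTheory.Automorphic.PicardCM
open Literature.NumberTheory.Automorphic.Liu2021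
open Literature.NumberTheory.Automorphic.Liu2021.AppendixC
open Literature.NumberTheory.Automorphic.Liu2021.AppendixC.RestOne
open Literature.NumberTheory.Automorphic.Liu2021.Def411WeilCarriers (JW TW isSymm_TW isUnit_det_TW JW_eq JW_apply_ne_zero locF lineOf Rep
  Eps Chi epsOf omegaAtLine rhoAtLine rhoVAtLine lineChar)
open Literature.NumberTheory.GelbartRogawski1991 Literature.NumberTheory.GelbartRogawski1991.UnitaryDualPair
open Literature.NumberTheory.Weil1964 Literature.RepresentationTheory
open Literature.RepresentationTheory.Liu2021
open Summit.HodgeConjecture.CorCM.Transposition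
open Summit.HodgeConjecture.CorCM.Transposition.OmegaTransport

/-! ## §1 One line, loose fields: `σ ∕ hσ ∕ e ∕ he` exist along any compatible splitting equal to `ι_{toHecke μ}`, at any rest equal to the δ′ rest -/

section Line

set_option maxHeartbeats 2000000 in
-- (two `subst`s on local variables, then prove-4's terms; the `splittingDatum` telescope needs the same budget as `omegaTransportAtDeltaPrime`)
/-- **The Ω-pin at ONE index line (loose fields).**  For a line `(T_W′, J_W′)` EQUAL to the line of record `(T_W (r ε), J_W (r ε))` (`hT ∕ hJ`),
ANY compatible pair splitting `s` of the dual-pair datum at `(diag dV, J_W′)` EQUAL to the splitting `ι_{toHecke μ}` attached to `μ` (`hsEq`;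
[GelbartRogawski1991, Remark p. 457]), ANY rest `R` EQUAL to the δ′ rest (`hR`), and a family `χof : Adm → (U(J_W′)(𝔸_f) →* ℂˣ)` of characters
with open kernels and trivial rational restrictions ([Liu2021, Def. 4.11] third bullet), injective: there are an INJECTIVE index map
`σ : Adm → AdmIndex` (Def. 4.12's admissible index `(ε, χ ∘ centre)`, witness `(r ε)·(2δ_F)⁻¹`) and `ℂ`-linear isomorphisms
`e a : Ω(s, χof a)|_{ιV} ≃ ω(μ, ε, χof a ∘ centre) = (toThm418Data … R).omegaAt (σ a)` that are `𝔾(𝔸^∞)`-EQUIVARIANT (and, at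
`R := restOfCharDeltaPrime …`, the identity on representatives — prove-4's `omegaTransportAtDeltaPrime_mk`).
[cite: Liu2021, Def. 4.11 (FJcycle.tex l. 2088–2096), Def. 4.12 (l. 2102–2108), Thm. 4.18 (l. 2232–2237), App. D §D.1 Steps 1–3 (l. 5215–5221)]
[cite: GelbartRogawski1991, §3.1 Prop. 3.1.1 p. 455 L1–3, Remark p. 457 L4–13] -/
theorem exists_omegaPin_line (h : exists_recordSystem) (F : CMField) [IsGalois ℚ F] (h6 : 6 ≤ Module.finrank ℚ F)
    (ι₁ : F →+* ℂ) (V : HermSpace3 F ι₁) (Φ : CMType F) {n : ℕ} (e : Fin 3 × Fin 1 ≃ Fin n) (dV : Fin 3 → F)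
    (hdV : ∀ i, IsCMField.complexConj F (dV i) = dV i) (hdV0 : ∀ i, dV i ≠ 0)
    (ιV : (sec42DataOf h isoOf F ι₁ V Φ).G →*
      UnitaryGroup.finAdelic ↥(maximalRealSubfield F) F (IsCMField.complexConj F) 3 (Matrix.diagonal dV))
    (r : Rep ↥(maximalRealSubfield F) (imagUnitSq F))
    (μ : Literature.NumberTheory.Automorphic.IdeleClassGroup F →ₜ* Circle)
    (hμ : Literature.NumberTheory.Automorphic.IdeleClassGroup.IsConjugateSymplectic F μ)
    (hw : Literature.NumberTheory.Automorphic.IdeleClassGroup.HasWeight F μ 1)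
    (R : Thm418Rest (sec42DataOf h isoOf F ι₁ V Φ)) (hR : restOfCharDeltaPrime h F h6 ι₁ V Φ e dV hdV hdV0 ιV r μ hμ hw = R)
    (ε : Eps ↥(maximalRealSubfield F) (imagUnitSq F)) (hε : ∃ a, locF ↥(maximalRealSubfield F) (imagUnitSq F) a = ε)
    (hΦ : ∀ τ : F →+* ℂ, τ ∈ hμ.cmType.1 → 0 < (τ (imagUnit F * algebraMap ↥(maximalRealSubfield F) F (r.toFun ε))).im)
    (TW' : Matrix (Fin 1) (Fin 1) ↥(maximalRealSubfield F)) (JW' : Matrix (Fin 1) (Fin 1) F)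
    (hW' : TW'.IsSymm) (hWd' : IsUnit TW'.det) (hJW' : JW' = TW'.map (algebraMap ↥(maximalRealSubfield F) F))
    (hT : TW ↥(maximalRealSubfield F) (r.toFun ε) = TW') (hJ : JW ↥(maximalRealSubfield F) F (r.toFun ε) = JW')
    (s : UnitaryGroup.adelicPair ↥(maximalRealSubfield F) F (IsCMField.complexConj F) 3 1 (Matrix.diagonal dV) JW' →*
      adelicMpCont ↥(maximalRealSubfield F) (Fin n) (adelicGram ↥(maximalRealSubfield F) e (realDiagonal F dV hdV) TW'))
    (hs : (splittingDatum ↥(maximalRealSubfield F) F (IsCMField.complexConj F) 3 1 e (Matrix.diagonal dV) JW'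
        (complexConj_imagUnit F) (imagUnit_ne_zero F) (imagUnit_mul_self F) (realDiagonal_isSymm F dV hdV) hW'
        (isUnit_det_realDiagonal F dV hdV hdV0) hWd' (realDiagonal_map F dV hdV).symm hJW').IsCompatible s)
    (hsEq : s = Def411WeilCarriersDoubling.chiSplittingLine F e dV hdV hdV0 (toHeckeCharacter F μ) (isUnitary_toHeckeCharacter F μ)
        ((isOscillatorChar_toHeckeCharacter_iff μ).mpr hμ) TW' hWd' JW' hJW')
    {Adm : Type} (χof : Adm → (↥(UnitaryGroup.finAdelic ↥(maximalRealSubfield F) F (IsCMField.complexConj F) 1 JW') →* ℂˣ))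
    (hGC : ∀ a : Adm,
      IsOpen (((χof a).ker : Subgroup _) : Set ↥(UnitaryGroup.finAdelic ↥(maximalRealSubfield F) F (IsCMField.complexConj F) 1 JW')) ∧
        ∀ γ : UnitaryGroup.rational ↥(maximalRealSubfield F) F (IsCMField.complexConj F) 1 JW',
          χof a (UnitaryGroup.rationalToFinAdelic ↥(maximalRealSubfield F) F (IsCMField.complexConj F) 1 JW' γ) = 1)
    (hχof : Function.Injective χof) :
    ∃ (σ : Adm → (toThm418Data (sec42DataOf h isoOf F ι₁ V Φ) R).AdmIndex) (_ : Function.Injective σ)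
      (e' : ∀ a : Adm, Representation.asModule
          ((HodgeCM.WeilCoinv.weilCoinv ↥(maximalRealSubfield F) F (IsCMField.complexConj F) 3 1 e (Matrix.diagonal dV) JW'
            (complexConj_imagUnit F) (imagUnit_ne_zero F) (imagUnit_mul_self F) (realDiagonal_isSymm F dV hdV) hW'
            (isUnit_det_realDiagonal F dV hdV hdV0) hWd' (realDiagonal_map F dV hdV).symm hJW' (χof a) hs).comp ιV) ≃ₗ[ℂ]
        (toThm418Data (sec42DataOf h isoOf F ι₁ V Φ) R).omegaAt (σ a)),
      ∀ (a : Adm) (g : (sec42DataOf h isoOf F ι₁ V Φ).G) (m : Representation.asModule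
          ((HodgeCM.WeilCoinv.weilCoinv ↥(maximalRealSubfield F) F (IsCMField.complexConj F) 3 1 e (Matrix.diagonal dV) JW'
            (complexConj_imagUnit F) (imagUnit_ne_zero F) (imagUnit_mul_self F) (realDiagonal_isSymm F dV hdV) hW'
            (isUnit_det_realDiagonal F dV hdV hdV0) hWd' (realDiagonal_map F dV hdV).symm hJW' (χof a) hs).comp ιV)),
        e' a (MonoidAlgebra.of ℂ (sec42DataOf h isoOf F ι₁ V Φ).G g • m) =
          (toThm418Data (sec42DataOf h isoOf F ι₁ V Φ) R).rhoAt (σ a) g (e' a m) := by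
  subst hR
  subst hsEq
  exact ⟨fun a => admIndexAtDeltaPrime h F h6 ι₁ V Φ e dV hdV hdV0 ιV r μ hμ hw ε hε hΦ JW' hJ ⟨χof a, hGC a⟩,
    fun a b hab => hχof (congrArg Subtype.val
      (admIndexAtDeltaPrime_injective h F h6 ι₁ V Φ e dV hdV hdV0 ιV r μ hμ hw ε hε hΦ JW' hJ hab)),
    fun a => omegaTransportAtDeltaPrime h F h6 ι₁ V Φ e dV hdV hdV0 ιV r μ hμ hw ε hε hΦ TW' JW' hW' hWd' hJW' hT hJ hs ⟨χof a, hGC a⟩,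
    fun a g m => omegaTransportAtDeltaPrime_smul h F h6 ι₁ V Φ e dV hdV hdV0 ιV r μ hμ hw ε hε hΦ TW' JW' hW' hWd' hJW' hT hJ hs
      ⟨χof a, hGC a⟩ g m⟩

end Line

/-! ## §2 The family form at port index lines over `L : HodgeCM.CMField` — group (b) of the assembler's pin signatures

The pinned dictionary's lines are port `SplitLine`s over the V-side constants of record (`SplitLineE V`: `dV := frameD V`, `ιV := ιVE V`);
its binder `T.Ω i a` is `(line i).Ω (ιVE V) a.1`.  The rests are read, as the assembler's `C`, at the tree codes `⟨L.K⟩ : CMField` and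
`⟨V.Hm, V.isHermitian, V.signature_ι₁, V.posDef_of_ne⟩ : HermSpace3 ⟨L.K⟩ ι₁` of the port's `L`, `V` (same carriers, same instances).  At the literal
pin: `Adm i := {χ ∕∕ (line i).IsAutChar χ}`, `χof i a := a.1`, `hGC i a := ((line i).isAutChar_iff a.1).1 a.2`, `hχof i := Subtype.val_injective`,
`PhiMu i := SplitLine.PhiMuLine ι₁ (line i)`; per line `r := repOfLine a_i` (prove-4's `OmegaAtDeltaPrimeLine`), `R := (U i hφ hg).rest (tail i hφ hg)`,
`hR := Model.restOfCharRep_eq_rest …` (own-htheta's `Item6UniformOmegaRep`). -/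

section Family

set_option maxHeartbeats 2000000 in
/-- **THE Ω-PIN, FAMILY FORM — `σ ∕ hσ ∕ e ∕ he` EXIST at every good index line**, given per-line δ′-keys: the line's conjugate-symplectic
weight-one Hecke character `μ_i`, a representative section `r_i` with the line-of-record equalities `hT ∕ hJ`, the global collection `ε_i` with
the orientation `hΦ` (`Φ_{μ_i}` δ-positive at `r_i ε_i`), the splitting identification `hsEq` (X3-Char at the line) and the rest of record `R i`
with `hR : restOfCharDeltaPrime … = R i`.  Proof: `exists_omegaPin_line` at every good line (`Classical.choice` over the index, inside the proof only).
[cite: Liu2021, Def. 4.11 (FJcycle.tex l. 2088–2096), Def. 4.12 (l. 2102–2108), Thm. 4.18 (l. 2232–2237), App. D §D.1 Steps 1–3 (l. 5215–5221)]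
[cite: GelbartRogawski1991, §3.1 Prop. 3.1.1 p. 455 L1–3, Remark p. 457 L4–13] -/
theorem exists_omegaPin (h : exists_recordSystem) {L : HodgeCM.CMField} [IsGalois ℚ L] (h6 : 6 ≤ Module.finrank ℚ L)
    {ι₁ : L →+* ℂ} (V : HodgeCM.HermSpace3 L ι₁) (Φ : CMType L)
    (dV : Fin 3 → L) (hdV : ∀ i, IsCMField.complexConj L (dV i) = dV i) (hdV0 : ∀ i, dV i ≠ 0)
    (ιV : (sec42DataOf h isoOf ⟨L.K⟩ ι₁ ⟨V.Hm, V.isHermitian, V.signature_ι₁, V.posDef_of_ne⟩ Φ).G →*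
      UnitaryGroup.finAdelic ↥(maximalRealSubfield L) L (IsCMField.complexConj L) 3 (Matrix.diagonal dV))
    {Char : Type} (Adm : Char → Type)
    (line : Char → HodgeCM.Model.SplitLine (Matrix.diagonal dV) (realDiagonal L dV hdV) (complexConj_imagUnit L) (imagUnit_ne_zero L)
      (imagUnit_mul_self L) (realDiagonal_isSymm L dV hdV) (isUnit_det_realDiagonal L dV hdV hdV0) (realDiagonal_map L dV hdV).symm)
    (χof : (i : Char) → Adm i → (line i).CharW)
    (hGC : ∀ (i : Char) (a : Adm i),
      IsOpen (((χof i a).ker : Subgroup _) :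
        Set ↥(UnitaryGroup.finAdelic ↥(maximalRealSubfield L) L (IsCMField.complexConj L) 1 (line i).JW)) ∧
      ∀ γ : UnitaryGroup.rational ↥(maximalRealSubfield L) L (IsCMField.complexConj L) 1 (line i).JW,
        χof i a (UnitaryGroup.rationalToFinAdelic ↥(maximalRealSubfield L) L (IsCMField.complexConj L) 1 (line i).JW γ) = 1)
    (hχof : ∀ i : Char, Function.Injective (χof i))
    (PhiMu Good : Char → Prop)
    -- the per-line δ′-keys
    (r : ∀ i : Char, PhiMu i → Good i → Rep ↥(maximalRealSubfield L) (imagUnitSq L))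
    (μ : ∀ i : Char, PhiMu i → Good i → (Literature.NumberTheory.Automorphic.IdeleClassGroup L →ₜ* Circle))
    (hμ : ∀ (i : Char) (hφ : PhiMu i) (hg : Good i),
      Literature.NumberTheory.Automorphic.IdeleClassGroup.IsConjugateSymplectic L (μ i hφ hg))
    (hw : ∀ (i : Char) (hφ : PhiMu i) (hg : Good i), Literature.NumberTheory.Automorphic.IdeleClassGroup.HasWeight L (μ i hφ hg) 1)
    (R : ∀ i : Char, PhiMu i → Good i → Thm418Rest (sec42DataOf h isoOf ⟨L.K⟩ ι₁ ⟨V.Hm, V.isHermitian, V.signature_ι₁, V.posDef_of_ne⟩ Φ))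
    (hR : ∀ (i : Char) (hφ : PhiMu i) (hg : Good i),
      restOfCharDeltaPrime h ⟨L.K⟩ h6 ι₁ ⟨V.Hm, V.isHermitian, V.signature_ι₁, V.posDef_of_ne⟩ Φ (line i).e dV hdV hdV0 ιV (r i hφ hg)
        (μ i hφ hg) (hμ i hφ hg) (hw i hφ hg) = R i hφ hg)
    (ε : ∀ i : Char, PhiMu i → Good i → Eps ↥(maximalRealSubfield L) (imagUnitSq L))
    (hε : ∀ (i : Char) (hφ : PhiMu i) (hg : Good i), ∃ a, locF ↥(maximalRealSubfield L) (imagUnitSq L) a = ε i hφ hg)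
    (hΦ : ∀ (i : Char) (hφ : PhiMu i) (hg : Good i), ∀ τ : L →+* ℂ, τ ∈ (hμ i hφ hg).cmType.1 →
      0 < (τ (imagUnit L * algebraMap ↥(maximalRealSubfield L) L ((r i hφ hg).toFun (ε i hφ hg)))).im)
    (hT : ∀ (i : Char) (hφ : PhiMu i) (hg : Good i), TW ↥(maximalRealSubfield L) ((r i hφ hg).toFun (ε i hφ hg)) = (line i).TW)
    (hJ : ∀ (i : Char) (hφ : PhiMu i) (hg : Good i), JW ↥(maximalRealSubfield L) L ((r i hφ hg).toFun (ε i hφ hg)) = (line i).JW)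
    (hsEq : ∀ (i : Char) (hφ : PhiMu i) (hg : Good i),
      (line i).s = Def411WeilCarriersDoubling.chiSplittingLine L (line i).e dV hdV hdV0 (toHeckeCharacter L (μ i hφ hg))
        (isUnitary_toHeckeCharacter L (μ i hφ hg)) ((isOscillatorChar_toHeckeCharacter_iff (μ i hφ hg)).mpr (hμ i hφ hg))
        (line i).TW (line i).hWd (line i).JW (line i).hJW) :
    ∃ (σ : ∀ (i : Char) (hφ : PhiMu i) (hg : Good i),
        Adm i → (toThm418Data (sec42DataOf h isoOf ⟨L.K⟩ ι₁ ⟨V.Hm, V.isHermitian, V.signature_ι₁, V.posDef_of_ne⟩ Φ) (R i hφ hg)).AdmIndex)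
      (_ : ∀ (i : Char) (hφ : PhiMu i) (hg : Good i), Function.Injective (σ i hφ hg))
      (e : ∀ (i : Char) (hφ : PhiMu i) (hg : Good i) (a : Adm i), (line i).Ω ιV (χof i a) ≃ₗ[ℂ]
        (toThm418Data (sec42DataOf h isoOf ⟨L.K⟩ ι₁ ⟨V.Hm, V.isHermitian, V.signature_ι₁, V.posDef_of_ne⟩ Φ) (R i hφ hg)).omegaAt
          (σ i hφ hg a)),
      ∀ (i : Char) (hφ : PhiMu i) (hg : Good i) (a : Adm i) (g : ↥V.adelicFin) (m : (line i).Ω ιV (χof i a)),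
        e i hφ hg a (MonoidAlgebra.of ℂ ↥V.adelicFin g • m) =
          (toThm418Data (sec42DataOf h isoOf ⟨L.K⟩ ι₁ ⟨V.Hm, V.isHermitian, V.signature_ι₁, V.posDef_of_ne⟩ Φ) (R i hφ hg)).rhoAt
            (σ i hφ hg a) g (e i hφ hg a m) := by
  classical
  have key := fun (i : Char) (hφ : PhiMu i) (hg : Good i) =>
    exists_omegaPin_line h ⟨L.K⟩ h6 ι₁ ⟨V.Hm, V.isHermitian, V.signature_ι₁, V.posDef_of_ne⟩ Φ (line i).e dV hdV hdV0 ιV (r i hφ hg)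
      (μ i hφ hg) (hμ i hφ hg) (hw i hφ hg) (R i hφ hg) (hR i hφ hg) (ε i hφ hg) (hε i hφ hg) (hΦ i hφ hg) (line i).TW (line i).JW
      (line i).hW (line i).hWd (line i).hJW (hT i hφ hg) (hJ i hφ hg) (line i).s (line i).hs (hsEq i hφ hg) (χof i) (hGC i) (hχof i)
  choose σ hσ e' he using key
  exact ⟨σ, hσ, e', he⟩

end Family

end Summit.HodgeConjecture.CorCM.Model

end
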